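import Mathlib
import Summits.Ventures.PercRepro2.K5Kernel

/-!
# Instance graphs on eight vertices with ten edges: the bitmask closure, the `K₃` tables and the
Kronecker certificate shape (blind cell PercRepro2, typer-1 g14)

The `K₅` certificate chain (`K5Kernel.lean` → `K5K3Kernel.lean` → `K5TypedK3.lean`) is generalised from
the complete graph on the five marks to ANY graph with ten edges on at most eight vertices: an
`Inst8` is an edge list `ea, eb : Fin 10 → ℕ` (endpoints `< 8`, distinct), the marks are
`o = 0, a₁ = 1, a₂ = 2, a₃ = 3` and `b` a parameter, the unmarked vertices are `5, 6, 7` (or fewer).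
Connectivity is the seven-fold bitmask closure (`nb`, `step`, `reach`, `conn`: a path on eight vertices
has length `≤ 7`); the twelve functions of p1's kernel `K₃` are the same twenty `0/1` tables as on `K₅`
(`K5K3Kernel.lean`), now through this closure; `kPos3 G b` / `kNeg3 G b` are their Kronecker numbers
(`K5.kron`, base `KB = 2^20`, one digit per profile `k ∈ {0,1,2,3}^10`), and `Cert3 G b` is the
digitwise-dominance certificate shape of `K5K3Kernel.Cert3`.  The bridge to the tree's events and to
`CovForm.TypedBases` is `Inst8Conn.lean` / `Inst8K3Tables.lean` / `Inst8TypedK3.lean`; an instance is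
certified by one `decide +kernel` (`Tri10Cert.lean`: the `|F| = 10` four-mark unmarked triangle).
-/

namespace Summit.Ventures.PercRepro2

namespace Inst8

/-! ## Instance graphs -/

/-- A graph with ten edges on the vertices `0, …, 7`: the two endpoints of every edge, distinct and
below `8`. -/
structure Inst where
  /-- First endpoint of edge `e`. -/
  ea : Fin 10 → ℕ
  /-- Second endpoint of edge `e`. -/
  eb : Fin 10 → ℕ
  /-- The endpoints are below `8`. -/
  ea_lt : ∀ e, ea e < 8
  /-- The endpoints are below `8`. -/
  eb_lt : ∀ e, eb e < 8
  /-- The endpoints are distinct (no loops). -/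
  ea_ne_eb : ∀ e, ea e ≠ eb e

/-! ## The bitmask closure on eight vertices -/

/-- The neighbour bitmask of the vertex `u` in the open subgraph of `ω`. -/
def nb (G : Inst) (ω : Fin 10 → Bool) (u : ℕ) : ℕ :=
  (List.finRange 10).foldl (fun acc e =>
    if ω e then
      (if G.ea e = u then acc ||| (1 <<< G.eb e) else
        if G.eb e = u then acc ||| (1 <<< G.ea e) else acc)
    else acc) 0

/-- One closure step on a vertex bitmask: add the open neighbours of every vertex of `R`. -/
def step (G : Inst) (ω : Fin 10 → Bool) (R : ℕ) : ℕ :=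
  (List.range 8).foldl (fun acc v => if R.testBit v then acc ||| nb G ω v else acc) R

/-- The iterated closure. -/
def reachN (G : Inst) (ω : Fin 10 → Bool) (u : ℕ) : ℕ → ℕ
  | 0 => 1 <<< u
  | n + 1 => step G ω (reachN G ω u n)

/-- The vertices reached from `u` (seven steps suffice on eight vertices). -/
def reach (G : Inst) (ω : Fin 10 → Bool) (u : ℕ) : ℕ := reachN G ω u 7

/-- Computable connectivity `u ↔ v` in the open subgraph of `ω`. -/
def conn (G : Inst) (ω : Fin 10 → Bool) (u v : ℕ) : Bool := (reach G ω u).testBit v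

/-! ## The tables of the twelve functions of `K₃` (marks `0, 1, 2, 3, b`) -/

/-- `Q = {a₁ ↮ a₂}`. -/
def tQ (G : Inst) (ω : Fin 10 → Bool) : Bool := !conn G ω 1 2
/-- `PD = Q ∩ {a₃ ∉ C₁ ∪ C₂}`. -/
def tPD (G : Inst) (ω : Fin 10 → Bool) : Bool := tQ G ω && !conn G ω 1 3 && !conn G ω 2 3
/-- `PD ∩ {o ∈ C₁ ∪ C₂}`. -/
def tPDoU (G : Inst) (ω : Fin 10 → Bool) : Bool := tPD G ω && (conn G ω 1 0 || conn G ω 2 0)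
/-- `L_v = {v ∈ C₁}`: `v` joined to `a₁ = 1`. -/
def tL (G : Inst) (v : ℕ) (ω : Fin 10 → Bool) : Bool := conn G ω 1 v
/-- `H_v = {v ∈ C₂}`: `v` joined to `a₂ = 2`. -/
def tH (G : Inst) (v : ℕ) (ω : Fin 10 → Bool) : Bool := conn G ω 2 v
/-- `U_v = {v ∈ C₁ ∪ C₂}`. -/
def tU (G : Inst) (v : ℕ) (ω : Fin 10 → Bool) : Bool := tL G v ω || tH G v ω
/-- `u` and `v` on the same side: the positive part of `σ_u σ_v`. -/
def tSame (G : Inst) (u v : ℕ) (ω : Fin 10 → Bool) : Bool :=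
  (tL G u ω && tL G v ω) || (tH G u ω && tH G v ω)
/-- `u` and `v` on opposite sides: the negative part of `σ_u σ_v`. -/
def tOpp (G : Inst) (u v : ℕ) (ω : Fin 10 → Bool) : Bool :=
  (tL G u ω && tH G v ω) || (tH G u ω && tL G v ω)
/-- `f₄⁺ = 1_Q 1_{o, b same side}`. -/
def t4p (G : Inst) (b : ℕ) (ω : Fin 10 → Bool) : Bool := tQ G ω && tSame G 0 b ω
/-- `f₄⁻ = 1_Q 1_{o, b opposite}`. -/
def t4m (G : Inst) (b : ℕ) (ω : Fin 10 → Bool) : Bool := tQ G ω && tOpp G 0 b ω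
/-- `f₅⁺ = 1_Q 1_{a₃, b same side}`. -/
def t5p (G : Inst) (b : ℕ) (ω : Fin 10 → Bool) : Bool := tQ G ω && tSame G 3 b ω
/-- `f₅⁻ = 1_Q 1_{a₃, b opposite}`. -/
def t5m (G : Inst) (b : ℕ) (ω : Fin 10 → Bool) : Bool := tQ G ω && tOpp G 3 b ω
/-- `f₆⁺ = 1_Q 1_{o∈U} 1_{a₃, b same side}`. -/
def t6p (G : Inst) (b : ℕ) (ω : Fin 10 → Bool) : Bool := tQ G ω && tU G 0 ω && tSame G 3 b ω
/-- `f₆⁻ = 1_Q 1_{o∈U} 1_{a₃, b opposite}`. -/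
def t6m (G : Inst) (b : ℕ) (ω : Fin 10 → Bool) : Bool := tQ G ω && tU G 0 ω && tOpp G 3 b ω
/-- `f₇⁺` at `v`: `1_Q 1_{v∈C₁}`. -/
def t7p (G : Inst) (v : ℕ) (ω : Fin 10 → Bool) : Bool := tQ G ω && tL G v ω
/-- `f₇⁻` at `v`: `1_Q 1_{v∈C₂}`. -/
def t7m (G : Inst) (v : ℕ) (ω : Fin 10 → Bool) : Bool := tQ G ω && tH G v ω
/-- `f₁₀⁺ = 1_Q 1_{a₃∈C₁} 1_{o∈U}`. -/
def t10p (G : Inst) (ω : Fin 10 → Bool) : Bool := tQ G ω && tL G 3 ω && tU G 0 ω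
/-- `f₁₀⁻ = 1_Q 1_{a₃∈C₂} 1_{o∈U}`. -/
def t10m (G : Inst) (ω : Fin 10 → Bool) : Bool := tQ G ω && tH G 3 ω && tU G 0 ω
/-- `f₁₁ = 1_PD 1_{o∈U} 1_{b∈U}`. -/
def t11 (G : Inst) (b : ℕ) (ω : Fin 10 → Bool) : Bool := tPD G ω && tU G 0 ω && tU G b ω
/-- `f₁₂ = 1_PD 1_{b∈U}`. -/
def t12 (G : Inst) (b : ℕ) (ω : Fin 10 → Bool) : Bool := tPD G ω && tU G b ω

/-! ## The Kronecker numbers and the certificate shape -/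

open K5 in
/-- The positive part of `K₃` on `G` (ten products, in the order `x, y, w` of the factors; the
order of `K5K3Kernel.kPos3`). -/
def kPos3 (G : Inst) (b : ℕ) : ℕ :=
  kron (tPD G) * kron (tQ G) * kron (t4p G b) + kron (tQ G) * kron (tPDoU G) * kron (t5p G b) +
    kron (tPD G) * kron (tQ G) * kron (t6m G b) +
    kron (tPD G) * kron (t7p G b) * kron (t7m G 0) + kron (tPD G) * kron (t7m G b) * kron (t7p G 0) +
    kron (tPDoU G) * kron (t7p G b) * kron (t7m G 3) +
    kron (tPDoU G) * kron (t7m G b) * kron (t7p G 3) +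
    kron (tPD G) * kron (t7p G b) * kron (t10p G) + kron (tPD G) * kron (t7m G b) * kron (t10m G) +
    kron (tQ G) * kron (t12 G b) * kron (tPDoU G)

open K5 in
/-- The negative part of `K₃` on `G` (ten products; the order of `K5K3Kernel.kNeg3`). -/
def kNeg3 (G : Inst) (b : ℕ) : ℕ :=
  kron (tPD G) * kron (tQ G) * kron (t4m G b) + kron (tQ G) * kron (tPDoU G) * kron (t5m G b) +
    kron (tPD G) * kron (tQ G) * kron (t6p G b) +
    kron (tPD G) * kron (t7p G b) * kron (t7p G 0) + kron (tPD G) * kron (t7m G b) * kron (t7m G 0) +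
    kron (tPDoU G) * kron (t7p G b) * kron (t7p G 3) +
    kron (tPDoU G) * kron (t7m G b) * kron (t7m G 3) +
    kron (tPD G) * kron (t7p G b) * kron (t10m G) + kron (tPD G) * kron (t7m G b) * kron (t10p G) +
    kron (tPD G) * kron (tQ G) * kron (t11 G b)

/-- **The certificate shape** (`K5K3Kernel.Cert3` for an instance graph): `kNeg3 G b ≤ kPos3 G b` and
the two mask tests — no borrow anywhere, the digits of `kNeg3 G b` below `2^19`. -/
def Cert3 (G : Inst) (b : ℕ) : Prop :=
  kNeg3 G b ≤ kPos3 G b ∧ Nat.land (kPos3 G b - kNeg3 G b) K5.mask = 0 ∧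
    Nat.land (kNeg3 G b) K5.mask = 0

end Inst8

end Summit.Ventures.PercRepro2
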